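import Summits.CriticalPhenomena.PercolationContinuityZ3.Theorems.SahiMasterFamilyUCCertSevenR
import Summits.CriticalPhenomena.PercolationContinuityZ3.Theorems.SahiMasterFamilyUCCertSevenD1
import Summits.CriticalPhenomena.PercolationContinuityZ3.Theorems.SahiMasterFamilyUCCertSevenD2
import Summits.CriticalPhenomena.PercolationContinuityZ3.Theorems.SahiMasterFamilyUCCertSevenD3
import Summits.CriticalPhenomena.PercolationContinuityZ3.Theorems.SahiMasterFamilyGHBridge
import Summits.CriticalPhenomena.PercolationContinuityZ3.Theorems.SahiMasterFamilyFUCMonotone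

/-!
# `F^{UC}(7)` and `(UC-hull)_7` — Sahi positivity of order 7 on the linear union-closed relaxation, by a kernel-checked certificate

Unit `prim-masterthm-p4` (gen 16; crux anchor stmt-CriticalPhenomena-4575, helper work; memo
`run/shared/lean/prim/prim-masterthm/prim-masterthm-p4/P4-GEN16-REPORT.md` §3; certificate: kit j152229 (direct HiGHS-IPM LP over the
structured family 'laminar pair of atoms × optional singleton box', atoms `β_S`, `1 − β_S`, `1 + (m−1)β_B − Σ β_{A_i}`, 11.6M orbit-columns, `S_7`-symmetrised, exact vertex, §13);
data generator `code-g16/gen_uccert.py`, independent exact re-verification `code-g16/cert_tools.py`).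
The unsymmetrised certificate `Q` has 263 products with integer weights (`M = 68740646591094191381791440`); `R = Q − 68740646591094191381791440·Φ_7` has 6535 monomials in
511 `S_7`-orbit classes, all class sums zero.  The kernel evaluates the four pieces of the orbit-basis check
(`PhiCert.fucNonneg_of_orbitPiecesU` of `…UCCert`) by `decide`.
* **`fucNonneg_seven : PhiCert.FUCNonneg 7`** — `Φ_7 ≥ 0` whenever `0 ≤ β ≤ 1`, `β_univ = 1` and the pairwise-covering inequalities hold.
* **`ucHullNonneg_seven : GHConjecture.UCHullNonneg 7`** — `(UC-hull)_7`; hence `(GH)_7` and PC-7 again (`gSystemNonneg_seven'`, `pcNonneg_seven'`).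
* with `…FUCMonotone`: **`fucNonneg_of_le_seven : k ≤ 7 → FUCNonneg k`**, **`ucHullNonneg_of_le_seven : k ≤ 7 → UCHullNonneg k`**.
HONEST FRAMING: `F^{UC}(n)` / `(UC-hull)_n` OPEN for `n ≥ 8`; Sahi's `C_k`, (GH)_k = PC-k (k ≥ 8) and the master theorem remain OPEN.
Axioms standard. [this work]
-/

set_option autoImplicit false

namespace Summit.CriticalPhenomena.PercolationContinuityZ3.Theorems

namespace PhiCert

/-- The orbit data `(c, g, κ)` (6535 entries), as the concatenation of its slices. [this work] -/
def ucD_seven : List (ℤ × List ℕ × Mono) :=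
  ucD_seven_1 ++ (ucD_seven_2 ++ (ucD_seven_3))

set_option maxRecDepth 200000 in
set_option maxHeartbeats 40000000 in
/-- **Well-formed permutations and vanishing orbit-class sums.** [this work] -/
theorem ucDataD_seven : checkDZ (6 + 1) ucD_seven = true := by
  decide +kernel

/-- **The relabelled orbit data IS the normal form** (assembled from the slices). [this work] -/
theorem ucReconD_seven : ucD_seven.map (recon (6 + 1)) = ucRD_seven := by
  show (ucD_seven_1 ++ (ucD_seven_2 ++ (ucD_seven_3))).map (recon (6 + 1)) = ucRD_seven_1 ++ (ucRD_seven_2 ++ (ucRD_seven_3))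
  simp only [List.map_append, ucReconD_seven_1, ucReconD_seven_2, ucReconD_seven_3]

/-- **`F^{UC}(7)` holds** (kernel theorem, standard axioms). [this work] -/
theorem fucNonneg_seven : FUCNonneg 7 :=
  fucNonneg_of_orbitPiecesU 6 68740646591094191381791440 (by norm_num) ucCert_seven ucD_seven ucRD_seven ucCheckT_seven ucDataD_seven ucNormR_seven ucReconD_seven

/-- **`(UC-hull)_7` holds.** [this work] -/
theorem ucHullNonneg_seven : GHConjecture.UCHullNonneg 7 :=
  ucHullNonneg_of_fucNonneg fucNonneg_seven

/-- `(GH)_7` through `(UC-hull)_7`. [this work] -/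
theorem gSystemNonneg_seven' : GHConjecture.GSystemNonneg 7 :=
  GHConjecture.gSystemNonneg_of_ucHullNonneg ucHullNonneg_seven

/-- PC-7 through `(UC-hull)_7` and `…GHBridge`. [this work] -/
theorem pcNonneg_seven' : GHBridge.PCNonneg 7 :=
  GHBridge.pcNonneg_of_ucHullNonneg ucHullNonneg_seven

/-- **`F^{UC}(k)` for every `k ≤ 7`** (with `…FUCMonotone`). [this work] -/
theorem fucNonneg_of_le_seven {k : ℕ} (hk : k ≤ 7) : FUCNonneg k := by
  rcases Nat.lt_or_ge k 7 with h | h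
  · exact fucNonneg_of_le_six (by omega)
  · obtain rfl : k = 7 := le_antisymm hk h
    exact fucNonneg_seven

/-- **`(UC-hull)_k` for every `k ≤ 7`.** [this work] -/
theorem ucHullNonneg_of_le_seven {k : ℕ} (hk : k ≤ 7) : GHConjecture.UCHullNonneg k :=
  ucHullNonneg_of_fucNonneg (fucNonneg_of_le_seven hk)

end PhiCert

end Summit.CriticalPhenomena.PercolationContinuityZ3.Theorems
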